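import Mathlib
import Summits.Ventures.FusionMHD.Models.CerfonFreidbergIterLikeQHalfGGJ
import Summits.Ventures.FusionMHD.Models.FluxSurfacePolarRayLevelGGJHalf
import HarnessLib

/-!
# Ventures/FusionMHD — Models/CerfonFreidbergIterLikeQHalfGGJHalf.lean: the Mercier criterion at `ψ_N = 1/2` of THE Cerfon–Freidberg
# ITER-like flux as ONE polynomial inequality in the SIX `[0, π]` registers of ★ #117's 32-panel half (up–down symmetry)

HONEST FRAMING (LADDER-GRIDFUSION three columns; CF rung, F2 item R2; «F2.R2-POLAR-GGJ-DATA» instance part 2, LOW, no count).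
Companion of `Models/CerfonFreidbergIterLikeQHalfGGJ.lean` (the record `QHalf.ggjData F u`, the fields `Dfield`, `F2field`, `Gfield`,
`mercierCriterion_iff` with `[0, 2π]` registers) and of model-7's generic `Models/FluxSurfacePolarRayLevelGGJHalf.lean`
(`LevelLoop.mercierCriterion_ggjData_iff_half`).
* CERTIFIED (kernel; this file + imports, axioms standard): the second ray derivative field `F2field` and the gradient-squared field
  `Gfield` of THE flux are EVEN and `2π`-PERIODIC in `θ` (closed forms: `U_XX`, `U_YY`, `U_X` even in `Y`, `U_XY`, `U_Y` odd); hence,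
  with `U(X, −Y) = U(X, Y)` (`U_neg`) and `Dfield_neg/periodic`, for every level `u` with `|u − u₀| < 10⁻¹⁰` and at `u₀` (`ψ_N = 1/2`):
  **`mercierCriterion_iff_halfLoop` / `mercierCriterion_half_iff_halfLoop`** — Jardin's criterion (8.134) on the surface ⟺
  `0 < PolarRay.mercierRegisterForm F 1 (∫₀^π polarKernelDs/Dfield) (∫₀^π volKernelDs/Dfield) (∫₀^π invGradKernel) (∫₀^π sigmaSqKernel)
  (∫₀^π bsqGradKernel) (∫₀^π invBsqKernel)` along the certified radius — exactly the register shape of the 32-panel program on `[0, π]`.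
* VALIDATED (never used in a proof; HOME/models/model-7/g6/cf_registers.py, MODEL-7-NOTES §6): the `[0, 2π]` registers at `ψ_N = 1/2`
  are `Pd 199.3727`, `Wd 55.20283`, `Aσ 1009.827`, and at `F = 3/5`: `As 2489.149`, `AB 433.0425`, `Ai 38.32886` (halve for `[0, π]`);
  the form is positive for `F` above `≈ 0.4268` (VALIDATED threshold; the CERTIFIED near-axis threshold of this model is `0.5583`).
* MODELLED: analytic Cerfon–Freidberg family, ideal MHD; NECESSARY criterion of the MODEL — never «stable», never a device.
Typer/prover: gridfusion-model-7 (g6), 2026-08-27.  Citations: Jardin 2010 (8.134) [Jardin2010]; Freidberg 2014 (6.153) [Freidberg2014].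
-/

noncomputable section

open Set MeasureTheory intervalIntegral Filter Topology
open Literature.MathematicalPhysics.MHD Literature.MathematicalPhysics.MHD.CerfonFreidberg Literature.MathematicalPhysics.MHD.GradShafranov
  Literature.MathematicalPhysics.MHD.FluxGeometry Literature.MathematicalPhysics.MHD.Mercier.FluxForm
open Summit.Ventures.FusionMHD.Models.PolarRay

namespace Summit.Ventures.FusionMHD.Models.CFIterLike.QHalf

/-! ## §1 Parity in `Y` of the second partials; `F2field`, `Gfield` are even and `2π`-periodic in `θ` -/

/-- `U_XX` closed form is even in `Y`. [cite: Freidberg2014, §6.6.1 eq. (6.153)] -/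
theorem UXXc_negY (c : Fin 7 → ℝ) (X Y : ℝ) : UXXc c X (-Y) = UXXc c X Y := by unfold UXXc; ring
/-- `U_XY` closed form is odd in `Y`. [cite: Freidberg2014, §6.6.1 eq. (6.153)] -/
theorem UXYc_negY (c : Fin 7 → ℝ) (X Y : ℝ) : UXYc c X (-Y) = -UXYc c X Y := by unfold UXYc; ring
/-- `U_YY` closed form is even in `Y`. [cite: Freidberg2014, §6.6.1 eq. (6.153)] -/
theorem UYYc_negY (c : Fin 7 → ℝ) (X Y : ℝ) : UYYc c X (-Y) = UYYc c X Y := by unfold UYYc; ring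

/-- `F2field = ∂_s D_r` is even in `θ`. -/
theorem F2field_neg (θ s : ℝ) : F2field (-θ) s = F2field θ s := by
  unfold F2field F2c
  rw [Real.cos_neg, Real.sin_neg, show s * -Real.sin θ = -(s * Real.sin θ) by ring, UXXc_negY, UXYc_negY, UYYc_negY]
  ring

/-- `F2field` is `2π`-periodic in `θ`. -/
theorem F2field_periodic (θ s : ℝ) : F2field (θ + 2 * Real.pi) s = F2field θ s := by
  unfold F2field F2c
  rw [Real.cos_add_two_pi, Real.sin_add_two_pi]

/-- `Gfield = |∇U|²` along rays is even in `θ`. -/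
theorem Gfield_neg (θ s : ℝ) : Gfield (-θ) s = Gfield θ s := by
  unfold Gfield
  rw [Real.cos_neg, Real.sin_neg, show s * -Real.sin θ = -(s * Real.sin θ) by ring, UXc_negY, UYc_negY]
  ring

/-- `Gfield` is `2π`-periodic in `θ`. -/
theorem Gfield_periodic (θ s : ℝ) : Gfield (θ + 2 * Real.pi) s = Gfield θ s := by
  unfold Gfield
  rw [Real.cos_add_two_pi, Real.sin_add_two_pi]

/-- The flux is mirror-symmetric about the midplane through the axis `(X_a, 0)`: `U(X, 0 − z) = U(X, 0 + z)`. -/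
theorem U_symm (X z : ℝ) : U X (0 - z) = U X (0 + z) := by
  rw [zero_sub, zero_add]; exact U_neg X z

/-! ## §2 The criterion with the six `[0, π]` registers -/

/-- **(8.134) ON THE SURFACE `U = u` (`|u − u₀| < 10⁻¹⁰`) ⟺ `0 < mercierRegisterForm F 1` OF THE SIX `[0, π]` REGISTERS** along `ρ_u`
(fields `Dfield`, `F2field`, `Gfield`).  No value claimed. [cite: Jardin2010, §8.5.4 eq. (8.134)] -/
theorem mercierCriterion_iff_halfLoop {u : ℝ} (hu : u ∈ Ioo (u₀ - ((δQ : ℚ) : ℝ)) (u₀ + ((δQ : ℚ) : ℝ))) (F : ℝ) :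
    (ggjData F u).MercierCriterion ↔
    0 < mercierRegisterForm F 1
      (∫ θ in (0 : ℝ)..Real.pi, polarKernelDs Xa Dfield F2field θ (rayRadius U Xa 0 u θ) / Dfield θ (rayRadius U Xa 0 u θ))
      (∫ θ in (0 : ℝ)..Real.pi, volKernelDs Xa Dfield F2field θ (rayRadius U Xa 0 u θ) / Dfield θ (rayRadius U Xa 0 u θ))
      (∫ θ in (0 : ℝ)..Real.pi, invGradKernel Xa Dfield Gfield θ (rayRadius U Xa 0 u θ))
      (∫ θ in (0 : ℝ)..Real.pi, sigmaSqKernel F Xa Dfield Gfield θ (rayRadius U Xa 0 u θ))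
      (∫ θ in (0 : ℝ)..Real.pi, bsqGradKernel F Xa Dfield Gfield θ (rayRadius U Xa 0 u θ))
      (∫ θ in (0 : ℝ)..Real.pi, invBsqKernel F Xa Dfield Gfield θ (rayRadius U Xa 0 u θ)) :=
  levelLoop.mercierCriterion_ggjData_iff_half F box_facts.1 box_facts.2 box_facts₂.1 box_facts₂.2 box_factsG box_factsGS
    U_symm Dfield_neg Dfield_periodic F2field_neg F2field_periodic Gfield_neg Gfield_periodic hu

/-- **THE MERCIER CRITERION (8.134) AT `ψ_N = 1/2` OF THE CF ITER-like MODEL ⟺ `0 < mercierRegisterForm F 1 Pd Wd Aσ As AB Ai` WITH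
THE SIX `[0, π]` REGISTERS along ★ #117's certified radius `ρ`** — the register shape of the 32-panel program (`…QHalfData`), no doubling
(degree-two homogeneity).  What remains for a certified row: six top registers + tube constants (`LevelPanel.kernel_integral_tube`) and
one rational inequality.  NECESSARY criterion of the MODEL; no value, no sign claimed here. [cite: Jardin2010, §8.5.4 eq. (8.134)] -/
theorem mercierCriterion_half_iff_halfLoop (F : ℝ) : (ggjData F u₀).MercierCriterion ↔
    0 < mercierRegisterForm F 1
      (∫ θ in (0 : ℝ)..Real.pi, polarKernelDs Xa Dfield F2field θ (ρ θ) / Dfield θ (ρ θ))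
      (∫ θ in (0 : ℝ)..Real.pi, volKernelDs Xa Dfield F2field θ (ρ θ) / Dfield θ (ρ θ))
      (∫ θ in (0 : ℝ)..Real.pi, invGradKernel Xa Dfield Gfield θ (ρ θ))
      (∫ θ in (0 : ℝ)..Real.pi, sigmaSqKernel F Xa Dfield Gfield θ (ρ θ))
      (∫ θ in (0 : ℝ)..Real.pi, bsqGradKernel F Xa Dfield Gfield θ (ρ θ))
      (∫ θ in (0 : ℝ)..Real.pi, invBsqKernel F Xa Dfield Gfield θ (ρ θ)) :=
  mercierCriterion_iff_halfLoop u₀_mem F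

end Summit.Ventures.FusionMHD.Models.CFIterLike.QHalf

end
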